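import Literature.Analysis.FluidPDE.TaoCascadeDuhamel
import Literature.Analysis.FluidPDE.TaoCascadeNoLow
import Literature.Analysis.FluidPDE.TaoCascadeODEProofs
import HarnessLib

/-!
# Tao's averaged Navier–Stokes blow-up: Lemma 4.1 (equations of motion) — discharge of `equationsOfMotion`

T. Tao, *Finite time blowup for an averaged three-dimensional Navier–Stokes equation*,
J. Amer. Math. Soc. **29** (2016), 601–674 = arXiv:1402.0290v3 (held as `paper:arxiv-1402.0290`),
§4, Lemma 4.1 and its proof, pp. 21–23.

This file proves the named fact `equationsOfMotion` of `TaoCascadeMotion.lean` (Lemma 4.1, stated over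
the accepted objects `modeProjection`, `modeCoeff = X_{i,n}`, `modeEnergy = E_{i,n}` and the format
`TaoCascade.CascadeODESolution` of (4.6)–(4.13)) from the Duhamel representation of the modes of a
mild solution (`TaoCascadeDuhamel.lean`: `X_{i,n} = X̃`, `E_{i,n} = Ẽ` on `[0,∞)` with
`X̃' = -A + Re Q`, `Ẽ' = -B + (Re Q) X̃`, `B ≥ 0`, `½X̃² ≤ Ẽ`, `|A| ≤ Λ_n (2Ẽ)^{1/2}`,
`Λ_n = 4π²((1+ε₀)ⁿ(1+ε₀/2))²`), and closes the reduction chain of the paper down to Theorem 6.2: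

* **(4.10), (4.11), (4.12)** (Part XI): `motion_of_mild`
  (`|∂ₜX_{i,n} - ∑…| ≤ 4√2π²(1+ε₀/2)² (1+ε₀)^{2n} E_{i,n}^{1/2}`), `energy_ineq_of_mild`
  (`∂ₜE_{i,n} ≤ (∑…) X_{i,n}`), `defect_lower_of_mild` (`½X² ≤ E`), `defect_upper_of_mild`
  (`E ≤ ½X² + 8π²(1+ε₀/2)²(1+ε₀)^{2n} ∫₀ᵗ E`, from `(E - ½X²)' = -B + X A ≤ |X||A| ≤ 2Λ_n E` and the
  fundamental theorem of calculus), the initial conditions **(4.8)–(4.9)** `init_of_mild`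
  (orthonormality of the wavelets), and `C¹` regularity on `[0,∞)` (`contDiffOn_modeCoeff_of_mild`,
  `contDiffOn_modeEnergy_of_mild`, with the one-sided derivatives `derivWithin_…_of_mild`).
* **(4.6)–(4.7)** (Part XII): `apriori_of_mild` — `sup_{t ≤ T} sup_{i,n} (1+(1+ε₀)^{10n})|X_{i,n}(t)| < ∞` and
  the same for `E_{i,n}^{1/2}`, from Plancherel on the frequency shell of the mode
  (`sobolevWeight_enorm_modeProjection_le`: `‖u_{i,n}‖ ≤ (1+(1+ε₀)^{2n})^{-5}‖u‖_{H¹⁰}`) and the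
  `C⁰_t H¹⁰_x` bound `ContinuousInH10On.exists_bound`.
* **Lemma 4.1** (Part XIII): `equationsOfMotion_holds` — (4.13) is obtained at the ODE level from the
  cancellation (4.3) by the Gronwall argument of p. 23 (`TaoCascade.CascadeODESolution.of_cancelling`,
  `TaoCascadeNoLow.lean`).
* **The chain**: `localCascade_blowup_of_odeBlowup` (Thm 3.3 ⇐ Thm 4.2),
  `localCascade_blowup_of_noGlobalODESolution` (Thm 3.3 ⇐ Thm 6.2, via the accepted
  `TaoCascade.odeBlowup_of_noGlobalODESolution`), and
  `averagedNS_blowup_of_isAveraged_of_noGlobalODESolution` (Thm 1.5 ⇐ Thm 3.2 + Thm 6.2).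

Equation numbers follow arXiv v3 / JAMS ((4.5) `E_{i,n}`, (4.6)–(4.7) a priori bounds, (4.8)–(4.9)
initial data, (4.10) motion, (4.11) energy inequality, (4.12) energy defect, (4.13) no low modes).

## References

* T. Tao, J. Amer. Math. Soc. 29 (2016), 601–674, arXiv:1402.0290v3, §4 Lemma 4.1, pp. 21–23.
  Key `Tao2016AveragedNS`.
-/

noncomputable section

open MeasureTheory Set Filter FourierTransform Metric
open scoped ENNReal NNReal SchwartzMap Topology RealInnerProductSpace Pointwise ComplexConjugate

namespace Literature.Analysis.FluidPDE.Tao2016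


/-! ## Part XI (numbering continues `TaoCascadeDuhamel.lean`): continuous differentiability, the equation of motion (4.10), the energy inequality (4.11), the energy defect (4.12) -/

section Regularity

variable {ε₀ : ℝ} {m : ℕ} {𝒟 : CascadeWaveletData ε₀ m}
  {α : Fin m → Fin m → Fin m → ℤ × ℤ × ℤ → ℝ} {u : ℝ → L2C} {i₀ i : Fin m} {n₀ n : ℤ}

/-- `A` is differentiable (same dominated differentiation, with the rate-weighted density), in
particular continuous. [folklore] -/
theorem continuous_modeDissX (hε : 0 < 1 + ε₀) (hQ : Continuous (modeForcingRe 𝒟 α u i n)) :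
    Continuous (modeDissX 𝒟 α u i n i₀ n₀) := by
  have h : ∀ t, HasDerivAt (modeDissX 𝒟 α u i n i₀ n₀) _ t := fun t =>
    (hasDerivAt_integral_duhamelScalar_pow (δ := modeDelta i₀ i n₀ n) hQ
      (integrable_heatRate_mul_modeWeight (𝒟 := 𝒟) (i := i) (n := n) hε)
      (heatRate_mul_modeWeight_eq_zero hε) 1 t).2
  exact continuous_iff_continuousAt.2 fun t => (h t).continuousAt

/-- `B` is continuous. [folklore] -/
theorem continuous_modeDissE (hε : 0 < 1 + ε₀) (hQ : Continuous (modeForcingRe 𝒟 α u i n)) :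
    Continuous (modeDissE 𝒟 α u i n i₀ n₀) := by
  have h : ∀ t, HasDerivAt (modeDissE 𝒟 α u i n i₀ n₀) _ t := fun t =>
    (hasDerivAt_integral_duhamelScalar_pow (δ := modeDelta i₀ i n₀ n) hQ
      (integrable_heatRate_mul_modeWeight (𝒟 := 𝒟) (i := i) (n := n) hε)
      (heatRate_mul_modeWeight_eq_zero hε) 2 t).2
  exact continuous_iff_continuousAt.2 fun t => (h t).continuousAt

/-- `X̃` is continuous. [folklore] -/
theorem continuous_modeScalarX (hε : 0 < 1 + ε₀) (hQ : Continuous (modeForcingRe 𝒟 α u i n)) :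
    Continuous (modeScalarX 𝒟 α u i n i₀ n₀) :=
  continuous_iff_continuousAt.2 fun t => (hasDerivAt_modeScalarX hε hQ t).continuousAt

/-- **`X̃` is `C¹` on `ℝ`** (its derivative `-A + Qr` is continuous). [cite: Tao2016AveragedNS, Lemma 4.1] -/
theorem contDiff_modeScalarX (hε : 0 < 1 + ε₀) (hQ : Continuous (modeForcingRe 𝒟 α u i n)) :
    ContDiff ℝ 1 (modeScalarX 𝒟 α u i n i₀ n₀) := by
  rw [contDiff_one_iff_deriv]
  refine ⟨fun t => (hasDerivAt_modeScalarX hε hQ t).differentiableAt, ?_⟩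
  have h : deriv (modeScalarX 𝒟 α u i n i₀ n₀) = fun t =>
      -modeDissX 𝒟 α u i n i₀ n₀ t + modeForcingRe 𝒟 α u i n t :=
    funext fun t => (hasDerivAt_modeScalarX hε hQ t).deriv
  rw [h]
  exact (continuous_modeDissX hε hQ).neg.add hQ

/-- **`Ẽ` is `C¹` on `ℝ`** (its derivative `-B + Qr X̃` is continuous). [cite: Tao2016AveragedNS, Lemma 4.1] -/
theorem contDiff_modeScalarE (hε : 0 < 1 + ε₀) (hQ : Continuous (modeForcingRe 𝒟 α u i n)) :
    ContDiff ℝ 1 (modeScalarE 𝒟 α u i n i₀ n₀) := by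
  rw [contDiff_one_iff_deriv]
  refine ⟨fun t => (hasDerivAt_modeScalarE hε hQ t).differentiableAt, ?_⟩
  have h : deriv (modeScalarE 𝒟 α u i n i₀ n₀) = fun t =>
      -modeDissE 𝒟 α u i n i₀ n₀ t + modeForcingRe 𝒟 α u i n t * modeScalarX 𝒟 α u i n i₀ n₀ t :=
    funext fun t => (hasDerivAt_modeScalarE hε hQ t).deriv
  rw [h]
  exact (continuous_modeDissE hε hQ).neg.add (hQ.mul (continuous_modeScalarX hε hQ))

/-- The real forcing of a mild solution is continuous. [folklore] -/
theorem continuous_modeForcingRe_of_mild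
    (hu : IsMildSolutionFor (cascadeOperatorForm ε₀ 𝒟.ψ α) (cascadeWavelet ε₀ (𝒟.ψ i₀) n₀) (Ici 0) u) :
    Continuous (modeForcingRe 𝒟 α u i n) :=
  continuous_modeForcingRe hu.2.1 fun s hs => (hu.1 s hs).2.1

/-- **`X_{i,n}` is continuously differentiable on `[0,+∞)`** (Lemma 4.1: "the `X_{i,n}` are
continuously differentiable"). [cite: Tao2016AveragedNS, Lemma 4.1] -/
theorem contDiffOn_modeCoeff_of_mild (hε : 0 < ε₀)
    (hu : IsMildSolutionFor (cascadeOperatorForm ε₀ 𝒟.ψ α) (cascadeWavelet ε₀ (𝒟.ψ i₀) n₀) (Ici 0) u) :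
    ContDiffOn ℝ 1 (modeCoeff 𝒟 u i n) (Ici 0) := by
  have hε' : 0 < 1 + ε₀ := by linarith
  exact (contDiff_modeScalarX (i := i) (n := n) (i₀ := i₀) (n₀ := n₀) hε'
    (continuous_modeForcingRe_of_mild (i := i) (n := n) hu)).contDiffOn.congr
    fun t ht => modeCoeff_eq_modeScalarX hε hu ht

/-- **`E_{i,n}` is continuously differentiable on `[0,+∞)`.** [cite: Tao2016AveragedNS, Lemma 4.1] -/
theorem contDiffOn_modeEnergy_of_mild (hε : 0 < ε₀)
    (hu : IsMildSolutionFor (cascadeOperatorForm ε₀ 𝒟.ψ α) (cascadeWavelet ε₀ (𝒟.ψ i₀) n₀) (Ici 0) u) :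
    ContDiffOn ℝ 1 (modeEnergy 𝒟 u i n) (Ici 0) := by
  have hε' : 0 < 1 + ε₀ := by linarith
  exact (contDiff_modeScalarE (i := i) (n := n) (i₀ := i₀) (n₀ := n₀) hε'
    (continuous_modeForcingRe_of_mild (i := i) (n := n) hu)).contDiffOn.congr
    fun t ht => modeEnergy_eq_modeScalarE hε hu ht

/-- The one-sided derivative of `X_{i,n}` on `[0,+∞)`: `∂ₜX_{i,n} = -A + quadTerm_{i,n}`. [cite: Tao2016AveragedNS, Lemma 4.1 (4.10)] -/
theorem derivWithin_modeCoeff_of_mild (hε : 0 < ε₀)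
    (hu : IsMildSolutionFor (cascadeOperatorForm ε₀ 𝒟.ψ α) (cascadeWavelet ε₀ (𝒟.ψ i₀) n₀) (Ici 0) u) {t : ℝ} (ht : 0 ≤ t) :
    derivWithin (modeCoeff 𝒟 u i n) (Ici 0) t =
      -modeDissX 𝒟 α u i n i₀ n₀ t + TaoCascade.quadTerm ε₀ α (modeCoeff 𝒟 u) i n t := by
  have hε' : 0 < 1 + ε₀ := by linarith
  have h := (hasDerivAt_modeScalarX (i := i) (n := n) (i₀ := i₀) (n₀ := n₀) hε'
    (continuous_modeForcingRe_of_mild (i := i) (n := n) hu) t).hasDerivWithinAt (s := Ici 0)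
  have h2 : HasDerivWithinAt (modeCoeff 𝒟 u i n)
      (-modeDissX 𝒟 α u i n i₀ n₀ t + modeForcingRe 𝒟 α u i n t) (Ici 0) t :=
    h.congr (fun s hs => modeCoeff_eq_modeScalarX hε hu hs) (modeCoeff_eq_modeScalarX hε hu ht)
  rw [h2.derivWithin (uniqueDiffOn_Ici 0 t ht), modeForcingRe_of_nonneg ht]

/-- The one-sided derivative of `E_{i,n}` on `[0,+∞)`: `∂ₜE_{i,n} = -B + quadTerm_{i,n} X_{i,n}`. [cite: Tao2016AveragedNS, Lemma 4.1 (4.11)] -/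
theorem derivWithin_modeEnergy_of_mild (hε : 0 < ε₀)
    (hu : IsMildSolutionFor (cascadeOperatorForm ε₀ 𝒟.ψ α) (cascadeWavelet ε₀ (𝒟.ψ i₀) n₀) (Ici 0) u) {t : ℝ} (ht : 0 ≤ t) :
    derivWithin (modeEnergy 𝒟 u i n) (Ici 0) t =
      -modeDissE 𝒟 α u i n i₀ n₀ t + TaoCascade.quadTerm ε₀ α (modeCoeff 𝒟 u) i n t * modeCoeff 𝒟 u i n t := by
  have hε' : 0 < 1 + ε₀ := by linarith
  have h := (hasDerivAt_modeScalarE (i := i) (n := n) (i₀ := i₀) (n₀ := n₀) hε'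
    (continuous_modeForcingRe_of_mild (i := i) (n := n) hu) t).hasDerivWithinAt (s := Ici 0)
  have h2 : HasDerivWithinAt (modeEnergy 𝒟 u i n)
      (-modeDissE 𝒟 α u i n i₀ n₀ t + modeForcingRe 𝒟 α u i n t * modeScalarX 𝒟 α u i n i₀ n₀ t) (Ici 0) t :=
    h.congr (fun s hs => modeEnergy_eq_modeScalarE hε hu hs) (modeEnergy_eq_modeScalarE hε hu ht)
  rw [h2.derivWithin (uniqueDiffOn_Ici 0 t ht), modeForcingRe_of_nonneg ht, ← modeCoeff_eq_modeScalarX hε hu ht]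

/-- **The energy inequality (4.11)**: `∂ₜ E_{i,n} ≤ quadTerm_{i,n} · X_{i,n}` on `[0,+∞)` (the dissipation
`B = -⟨Δu_{i,n}, u_{i,n}⟩ ≥ 0` is dropped). [cite: Tao2016AveragedNS, Lemma 4.1 (4.11)] -/
theorem energy_ineq_of_mild (hε : 0 < ε₀)
    (hu : IsMildSolutionFor (cascadeOperatorForm ε₀ 𝒟.ψ α) (cascadeWavelet ε₀ (𝒟.ψ i₀) n₀) (Ici 0) u) {t : ℝ} (ht : 0 ≤ t) :
    derivWithin (modeEnergy 𝒟 u i n) (Ici 0) t ≤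
      TaoCascade.quadTerm ε₀ α (modeCoeff 𝒟 u) i n t * modeCoeff 𝒟 u i n t := by
  rw [derivWithin_modeEnergy_of_mild (i₀ := i₀) (n₀ := n₀) hε hu ht]
  linarith [modeDissE_nonneg (𝒟 := 𝒟) (α := α) (u := u) (i := i) (n := n) (i₀ := i₀) (n₀ := n₀) t]

end Regularity

section Bounds

variable {ε₀ : ℝ} {m : ℕ} {𝒟 : CascadeWaveletData ε₀ m}
  {α : Fin m → Fin m → Fin m → ℤ × ℤ × ℤ → ℝ} {u : ℝ → L2C} {i₀ i : Fin m} {n₀ n : ℤ}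

/-- `((1+ε₀)ⁿ)² = (1+ε₀)^{2n}` with a real exponent (the format of `CascadeODESolution`). [folklore] -/
theorem zpow_sq_eq_rpow (hε : 0 < 1 + ε₀) (n : ℤ) : ((1 + ε₀) ^ n) ^ 2 = (1 + ε₀) ^ ((2 : ℝ) * n) := by
  rw [mul_comm, Real.rpow_mul hε.le, Real.rpow_intCast, Real.rpow_two]

/-- `Λ_n = 4π²(1+ε₀/2)² (1+ε₀)^{2n}`. [folklore] -/
theorem modeRateBound_eq (hε : 0 < 1 + ε₀) (n : ℤ) :
    modeRateBound ε₀ n = 4 * Real.pi ^ 2 * (1 + ε₀ / 2) ^ 2 * (1 + ε₀) ^ ((2 : ℝ) * n) := by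
  rw [modeRateBound, modeRadius, mul_pow, zpow_sq_eq_rpow hε]
  ring

/-- **The equation of motion (4.10)**:
`|∂ₜX_{i,n} - quadTerm_{i,n}| ≤ K₁ (1+ε₀)^{2n} E_{i,n}^{1/2}` on `[0,+∞)`. [cite: Tao2016AveragedNS, Lemma 4.1 (4.10)] -/
theorem motion_of_mild (hε : 0 < ε₀)
    (hu : IsMildSolutionFor (cascadeOperatorForm ε₀ 𝒟.ψ α) (cascadeWavelet ε₀ (𝒟.ψ i₀) n₀) (Ici 0) u)
    {t : ℝ} (ht : 0 ≤ t) :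
    |derivWithin (modeCoeff 𝒟 u i n) (Ici 0) t - TaoCascade.quadTerm ε₀ α (modeCoeff 𝒟 u) i n t| ≤
      4 * Real.sqrt 2 * Real.pi ^ 2 * (1 + ε₀ / 2) ^ 2 * (1 + ε₀) ^ ((2 : ℝ) * n) * Real.sqrt (modeEnergy 𝒟 u i n t) := by
  have hε' : 0 < 1 + ε₀ := by linarith
  have hQ := continuous_modeForcingRe_of_mild (i := i) (n := n) hu
  rw [derivWithin_modeCoeff_of_mild (i₀ := i₀) (n₀ := n₀) hε hu ht,
    show -modeDissX 𝒟 α u i n i₀ n₀ t + TaoCascade.quadTerm ε₀ α (modeCoeff 𝒟 u) i n t -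
      TaoCascade.quadTerm ε₀ α (modeCoeff 𝒟 u) i n t = -modeDissX 𝒟 α u i n i₀ n₀ t by ring, abs_neg]
  refine (abs_modeDissX_le hε' hQ t).trans (le_of_eq ?_)
  rw [← modeEnergy_eq_modeScalarE hε hu ht, Real.sqrt_mul' _ (modeEnergy_nonneg 𝒟 u i n t),
    modeRateBound_eq hε']
  ring

/-- **The energy defect (4.12), lower half**: `½ X_{i,n}² ≤ E_{i,n}` on `[0,+∞)`. [cite: Tao2016AveragedNS, Lemma 4.1 (4.12)] -/
theorem defect_lower_of_mild (hε : 0 < ε₀)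
    (hu : IsMildSolutionFor (cascadeOperatorForm ε₀ 𝒟.ψ α) (cascadeWavelet ε₀ (𝒟.ψ i₀) n₀) (Ici 0) u)
    {t : ℝ} (ht : 0 ≤ t) :
    (1 / 2) * modeCoeff 𝒟 u i n t ^ 2 ≤ modeEnergy 𝒟 u i n t := by
  have hε' : 0 < 1 + ε₀ := by linarith
  rw [modeCoeff_eq_modeScalarX (i₀ := i₀) (n₀ := n₀) hε hu ht, modeEnergy_eq_modeScalarE (i₀ := i₀) (n₀ := n₀) hε hu ht]
  exact half_sq_modeScalarX_le hε' (continuous_modeForcingRe_of_mild hu) t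

/-- **Initial values**: `X̃(0) = δ`, `Ẽ(0) = δ²/2`. [cite: Tao2016AveragedNS, Lemma 4.1 (4.8)–(4.9)] -/
theorem modeScalar_zero (hε : 0 < 1 + ε₀) :
    modeScalarX 𝒟 α u i n i₀ n₀ 0 = modeDelta i₀ i n₀ n ∧
      modeScalarE 𝒟 α u i n i₀ n₀ 0 = modeDelta i₀ i n₀ n ^ 2 / 2 := by
  constructor
  · simp only [modeScalarX, duhamelScalar_zero, integral_const_mul, integral_modeWeight hε, mul_one]
  · simp only [modeScalarE, duhamelScalar_zero, integral_const_mul, integral_modeWeight hε, mul_one]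

/-- **The initial conditions (4.8)–(4.9)**: `X_{i,n}(0) = 1_{(i,n)=(i₀,n₀)}`, `E_{i,n}(0) = ½ X_{i,n}(0)²`. [cite: Tao2016AveragedNS, Lemma 4.1 (4.8)–(4.9)] -/
theorem init_of_mild (hε : 0 < ε₀)
    (hu : IsMildSolutionFor (cascadeOperatorForm ε₀ 𝒟.ψ α) (cascadeWavelet ε₀ (𝒟.ψ i₀) n₀) (Ici 0) u) :
    modeCoeff 𝒟 u i n 0 = (if i = i₀ ∧ n = n₀ then 1 else 0) ∧
      modeEnergy 𝒟 u i n 0 = (1 / 2) * modeCoeff 𝒟 u i n 0 ^ 2 := by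
  have hε' : 0 < 1 + ε₀ := by linarith
  obtain ⟨hX, hE⟩ := modeScalar_zero (𝒟 := 𝒟) (α := α) (u := u) (i := i) (n := n) (i₀ := i₀) (n₀ := n₀) hε'
  rw [modeCoeff_eq_modeScalarX (i₀ := i₀) (n₀ := n₀) hε hu le_rfl,
    modeEnergy_eq_modeScalarE (i₀ := i₀) (n₀ := n₀) hε hu le_rfl, hX, hE]
  refine ⟨?_, by ring⟩
  simp only [modeDelta]
  by_cases h : i = i₀ ∧ n = n₀
  · rw [if_pos ⟨h.1.symm, h.2.symm⟩, if_pos h]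
  · rw [if_neg (fun h' => h ⟨h'.1.symm, h'.2.symm⟩), if_neg h]

/-- **The energy defect (4.12), upper half**:
`E_{i,n}(t) ≤ ½ X_{i,n}(t)² + K₂ (1+ε₀)^{2n} ∫₀ᵗ E_{i,n}` on `[0,+∞)` (`∂ₜ(E - ½X²) = -B + X A ≤ 2Λ_n E`,
`E - ½X²` vanishes at `0`, and the fundamental theorem of calculus; Tao p. 22). [cite: Tao2016AveragedNS, Lemma 4.1 (4.12)] -/
theorem defect_upper_of_mild (hε : 0 < ε₀)
    (hu : IsMildSolutionFor (cascadeOperatorForm ε₀ 𝒟.ψ α) (cascadeWavelet ε₀ (𝒟.ψ i₀) n₀) (Ici 0) u)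
    {t : ℝ} (ht : 0 ≤ t) :
    modeEnergy 𝒟 u i n t ≤ (1 / 2) * modeCoeff 𝒟 u i n t ^ 2 +
      8 * Real.pi ^ 2 * (1 + ε₀ / 2) ^ 2 * (1 + ε₀) ^ ((2 : ℝ) * n) * ∫ s in (0 : ℝ)..t, modeEnergy 𝒟 u i n s := by
  have hε' : 0 < 1 + ε₀ := by linarith
  have hQ := continuous_modeForcingRe_of_mild (i := i) (n := n) hu
  set Λ := modeRateBound ε₀ n with hΛ
  set X := modeScalarX 𝒟 α u i n i₀ n₀ with hXdef
  set E := modeScalarE 𝒟 α u i n i₀ n₀ with hEdef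
  have hEc : Continuous E := (contDiff_modeScalarE (i := i) (n := n) (i₀ := i₀) (n₀ := n₀) hε' hQ).continuous
  -- the comparison function and its derivative
  set g : ℝ → ℝ := fun τ => E τ - (1 / 2) * X τ ^ 2 - 2 * Λ * ∫ s in (0 : ℝ)..τ, E s with hg
  have hgd : ∀ τ, HasDerivAt g ((-modeDissE 𝒟 α u i n i₀ n₀ τ + modeForcingRe 𝒟 α u i n τ * X τ) -
      (1 / 2) * (2 * X τ ^ (2 - 1) * (-modeDissX 𝒟 α u i n i₀ n₀ τ + modeForcingRe 𝒟 α u i n τ)) -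
      2 * Λ * E τ) τ := by
    intro τ
    have h1 := hasDerivAt_modeScalarE (i := i) (n := n) (i₀ := i₀) (n₀ := n₀) hε' hQ τ
    have h2 := ((hasDerivAt_modeScalarX (i := i) (n := n) (i₀ := i₀) (n₀ := n₀) hε' hQ τ).pow 2).const_mul (1 / 2 : ℝ)
    have h3 := (intervalIntegral.integral_hasDerivAt_right (hEc.intervalIntegrable 0 τ)
      (hEc.stronglyMeasurableAtFilter _ _) hEc.continuousAt).const_mul (2 * Λ)
    have h := (h1.sub h2).sub h3
    refine h.congr_deriv ?_
    push_cast
    ring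
  have hg'le : ∀ τ, (-modeDissE 𝒟 α u i n i₀ n₀ τ + modeForcingRe 𝒟 α u i n τ * X τ) -
      (1 / 2) * (2 * X τ ^ (2 - 1) * (-modeDissX 𝒟 α u i n i₀ n₀ τ + modeForcingRe 𝒟 α u i n τ)) -
      2 * Λ * E τ ≤ 0 := by
    intro τ
    have hB := modeDissE_nonneg (𝒟 := 𝒟) (α := α) (u := u) (i := i) (n := n) (i₀ := i₀) (n₀ := n₀) τ
    have hA := abs_modeDissX_le (i₀ := i₀) (n₀ := n₀) hε' hQ τ
    have hXa := abs_modeScalarX_le (i₀ := i₀) (n₀ := n₀) hε' hQ τ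
    have hE0 := modeScalarE_nonneg (𝒟 := 𝒟) (α := α) (u := u) (i := i) (n := n) (i₀ := i₀) (n₀ := n₀) τ
    have hXA : X τ * modeDissX 𝒟 α u i n i₀ n₀ τ ≤ 2 * Λ * E τ := by
      calc X τ * modeDissX 𝒟 α u i n i₀ n₀ τ ≤ |X τ| * |modeDissX 𝒟 α u i n i₀ n₀ τ| := by
            rw [← abs_mul]; exact le_abs_self _
        _ ≤ Real.sqrt (2 * E τ) * (Λ * Real.sqrt (2 * E τ)) :=
            mul_le_mul hXa hA (abs_nonneg _) (Real.sqrt_nonneg _)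
        _ = 2 * Λ * E τ := by
            rw [show Real.sqrt (2 * E τ) * (Λ * Real.sqrt (2 * E τ)) = Λ * (Real.sqrt (2 * E τ) * Real.sqrt (2 * E τ)) by ring,
              Real.mul_self_sqrt (by linarith)]
            ring
    simp only [pow_one, show (2 : ℕ) - 1 = 1 from rfl]
    nlinarith
  -- `g` is antitone on `[0,∞)` and vanishes at `0`
  have hanti : AntitoneOn g (Ici 0) :=
    antitoneOn_of_deriv_nonpos (convex_Ici 0) (fun τ _ => (hgd τ).continuousAt.continuousWithinAt)
      (fun τ _ => (hgd τ).differentiableAt.differentiableWithinAt) fun τ _ => by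
        rw [(hgd τ).deriv]; exact hg'le τ
  have hg0 : g 0 = 0 := by
    obtain ⟨hX0, hE0⟩ := modeScalar_zero (𝒟 := 𝒟) (α := α) (u := u) (i := i) (n := n) (i₀ := i₀) (n₀ := n₀) hε'
    simp only [hg, hXdef, hEdef, hX0, hE0, intervalIntegral.integral_same, mul_zero, sub_zero]
    ring
  have hgt : g t ≤ 0 := hg0 ▸ hanti (mem_Ici.2 le_rfl) (mem_Ici.2 ht) ht
  -- translate back to `X_{i,n}`, `E_{i,n}`
  have hint : ∫ s in (0 : ℝ)..t, modeEnergy 𝒟 u i n s = ∫ s in (0 : ℝ)..t, E s := by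
    refine intervalIntegral.integral_congr fun s hs => ?_
    rw [uIcc_of_le ht] at hs
    exact modeEnergy_eq_modeScalarE hε hu hs.1
  rw [modeCoeff_eq_modeScalarX (i₀ := i₀) (n₀ := n₀) hε hu ht, modeEnergy_eq_modeScalarE (i₀ := i₀) (n₀ := n₀) hε hu ht,
    hint, ← hXdef, ← hEdef]
  have h2Λ : 2 * Λ = 8 * Real.pi ^ 2 * (1 + ε₀ / 2) ^ 2 * (1 + ε₀) ^ ((2 : ℝ) * n) := by
    rw [hΛ, modeRateBound_eq hε']; ring
  have := hgt
  simp only [hg] at this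
  rw [← h2Λ]
  linarith

end Bounds

/-! ## Part XII: the a priori bounds (4.6)–(4.7) -/

section Apriori

variable {ε₀ : ℝ} {m : ℕ} {𝒟 : CascadeWaveletData ε₀ m}
  {α : Fin m → Fin m → Fin m → ℤ × ℤ × ℤ → ℝ} {u : ℝ → L2C} {i₀ i : Fin m} {n₀ n : ℤ}

/-- `1 + x⁵ ≤ (1 + x)⁵` for `x ≥ 0`. [folklore] -/
theorem one_add_pow_five_le {x : ℝ} (hx : 0 ≤ x) : 1 + x ^ 5 ≤ (1 + x) ^ 5 := by
  nlinarith [pow_nonneg hx 2, pow_nonneg hx 3, pow_nonneg hx 4, mul_nonneg hx (pow_nonneg hx 2)]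

/-- The Sobolev weight beats the decay weight: `(1 + (1+ε₀)^{10n}) (1 + (1+ε₀)^{2n})^{-5} ≤ 1`. [folklore] -/
theorem weight_le_one (hε : 0 < 1 + ε₀) (n : ℤ) :
    (1 + (1 + ε₀) ^ ((10 : ℝ) * n)) * (1 + ((1 + ε₀) ^ n) ^ 2) ^ (-(5 : ℝ)) ≤ 1 := by
  set c : ℝ := (1 + ε₀) ^ n with hc
  have hcpos : 0 < c := zpow_pos hε n
  have h10 : (1 + ε₀) ^ ((10 : ℝ) * n) = (c ^ 2) ^ 5 := by
    rw [← pow_mul, show 2 * 5 = 10 from rfl, mul_comm, Real.rpow_mul hε.le, Real.rpow_intCast, ← hc]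
    norm_cast
  rw [h10, Real.rpow_neg (by positivity), ← div_eq_mul_inv, div_le_one (by positivity)]
  have : ((1 + c ^ 2) ^ (5 : ℝ)) = (1 + c ^ 2) ^ (5 : ℕ) := by norm_cast
  rw [this]
  exact one_add_pow_five_le (by positivity)

/-- **The coefficient bound behind (4.6)**: `(1 + (1+ε₀)^{10n}) |X_{i,n}(t)| ≤ ‖u(t)‖_{H¹⁰}`. [cite: Tao2016AveragedNS, Lemma 4.1 (4.6)] -/
theorem weight_mul_abs_modeCoeff_le (hε : 0 < ε₀) {t : ℝ} (hfin : FunctionSpaces.eFourierSobolevNorm 10 (u t) < ⊤) :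
    (1 + (1 + ε₀) ^ ((10 : ℝ) * n)) * |modeCoeff 𝒟 u i n t| ≤
      (FunctionSpaces.eFourierSobolevNorm 10 (u t)).toReal := by
  have hε' : 0 < 1 + ε₀ := by linarith
  set K : ℝ := (1 + ((1 + ε₀) ^ n) ^ 2) ^ (-(5 : ℝ)) with hK
  have hK0 : 0 ≤ K := Real.rpow_nonneg (by positivity) _
  have h1 : |modeCoeff 𝒟 u i n t| ≤ K * (FunctionSpaces.eFourierSobolevNorm 10 (u t)).toReal := by
    have h := 𝒟.enorm_pairing_cascadeWavelet_le hε' i n (u t)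
    have hne : ENNReal.ofReal K * FunctionSpaces.eFourierSobolevNorm 10 (u t) ≠ ⊤ :=
      ENNReal.mul_ne_top ENNReal.ofReal_ne_top hfin.ne
    have h2 := ENNReal.toReal_mono hne h
    rw [← ofReal_norm, ENNReal.toReal_ofReal (norm_nonneg _), ENNReal.toReal_mul, ENNReal.toReal_ofReal hK0] at h2
    exact (Complex.abs_re_le_norm _).trans h2
  have hw := weight_le_one hε' n
  calc (1 + (1 + ε₀) ^ ((10 : ℝ) * n)) * |modeCoeff 𝒟 u i n t|
      ≤ (1 + (1 + ε₀) ^ ((10 : ℝ) * n)) * (K * (FunctionSpaces.eFourierSobolevNorm 10 (u t)).toReal) :=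
        mul_le_mul_of_nonneg_left h1 (by positivity)
    _ = ((1 + (1 + ε₀) ^ ((10 : ℝ) * n)) * K) * (FunctionSpaces.eFourierSobolevNorm 10 (u t)).toReal := by ring
    _ ≤ 1 * (FunctionSpaces.eFourierSobolevNorm 10 (u t)).toReal :=
        mul_le_mul_of_nonneg_right hw ENNReal.toReal_nonneg
    _ = _ := one_mul _

/-- **Decay of the projections**: `‖u_{i,n}‖ ≤ (1 + (1+ε₀)^{2n})^{-5} ‖u‖_{H¹⁰}` (in `ℝ≥0∞`; the
projection lives where `|ξ| > (1+ε₀)ⁿ`; Tao p. 22: "from Plancherel and the `C⁰_tH¹⁰_x` bound on `u`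
we have (4.7)"). [cite: Tao2016AveragedNS, Lemma 4.1 (4.7)] -/
theorem sobolevWeight_enorm_modeProjection_le (hε : 0 < 1 + ε₀) (i : Fin m) (n : ℤ) (v : L2C) :
    ‖modeProjection 𝒟 i n v‖ₑ ≤
      ENNReal.ofReal ((1 + ((1 + ε₀) ^ n) ^ 2) ^ (-(5 : ℝ))) * FunctionSpaces.eFourierSobolevNorm 10 v := by
  set c : ℝ := (1 + ε₀) ^ n with hc
  set K : ℝ := (1 + c ^ 2) ^ (-(5 : ℝ)) with hK
  have hK0 : 0 ≤ K := Real.rpow_nonneg (by positivity) _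
  rw [← FunctionSpaces.eFourierSobolevNorm_zero_eq_enorm]
  unfold FunctionSpaces.eFourierSobolevNorm
  have hpt : ∀ᵐ ξ ∂(volume : Measure (EuclideanSpace ℝ (Fin 3))),
      ENNReal.ofReal ((1 + ‖ξ‖ ^ 2) ^ (0 : ℝ)) * ‖fourierFn (modeProjection 𝒟 i n v) ξ‖ₑ ^ 2 ≤
        ENNReal.ofReal K ^ 2 * (ENNReal.ofReal ((1 + ‖ξ‖ ^ 2) ^ (10 : ℝ)) * ‖fourierFn v ξ‖ₑ ^ 2) := by
    filter_upwards [fourierFn_modeProjection 𝒟 i n v] with ξ hξ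
    rw [hξ, Real.rpow_zero, ENNReal.ofReal_one, one_mul]
    by_cases hmem : ξ ∈ freqRegion 𝒟 i n
    · rw [indicator_of_mem hmem, one_smul, ← mul_assoc]
      refine le_mul_of_one_le_left zero_le ?_
      have hξc : c < ‖ξ‖ := (𝒟.norm_of_mem_freqRegion hε i n hmem).1
      rw [← ENNReal.ofReal_pow hK0, ← ENNReal.ofReal_mul (by positivity), ← ENNReal.ofReal_one]
      refine ENNReal.ofReal_le_ofReal ?_
      have hcpos : 0 < c := zpow_pos hε n
      have hcξ : c ^ 2 ≤ ‖ξ‖ ^ 2 := pow_le_pow_left₀ hcpos.le hξc.le 2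
      have hb : (1 + c ^ 2) ^ (10 : ℝ) ≤ (1 + ‖ξ‖ ^ 2) ^ (10 : ℝ) :=
        Real.rpow_le_rpow (by positivity) (by linarith) (by norm_num)
      have hK2 : K ^ 2 = ((1 + c ^ 2) ^ (10 : ℝ))⁻¹ := by
        rw [hK, ← Real.rpow_natCast, ← Real.rpow_mul (by positivity), ← Real.rpow_neg (by positivity)]
        norm_num
      rw [hK2, inv_mul_eq_div, le_div_iff₀ (by positivity), one_mul]
      exact hb
    · rw [indicator_of_notMem hmem, zero_smul, enorm_zero, zero_pow two_ne_zero]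
      exact zero_le
  calc (∫⁻ ξ, ENNReal.ofReal ((1 + ‖ξ‖ ^ 2) ^ (0 : ℝ)) *
        ‖fourierFn (modeProjection 𝒟 i n v) ξ‖ₑ ^ 2 ∂(volume : Measure (EuclideanSpace ℝ (Fin 3)))) ^ (1 / 2 : ℝ)
      ≤ (ENNReal.ofReal K ^ 2 * ∫⁻ ξ, ENNReal.ofReal ((1 + ‖ξ‖ ^ 2) ^ (10 : ℝ)) * ‖fourierFn v ξ‖ₑ ^ 2
          ∂(volume : Measure (EuclideanSpace ℝ (Fin 3)))) ^ (1 / 2 : ℝ) := by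
        refine ENNReal.rpow_le_rpow ?_ (by norm_num)
        rw [← lintegral_const_mul' _ _ (ENNReal.pow_ne_top ENNReal.ofReal_ne_top)]
        exact lintegral_mono_ae hpt
    _ = ENNReal.ofReal K * (∫⁻ ξ, ENNReal.ofReal ((1 + ‖ξ‖ ^ 2) ^ (10 : ℝ)) * ‖fourierFn v ξ‖ₑ ^ 2
          ∂(volume : Measure (EuclideanSpace ℝ (Fin 3)))) ^ (1 / 2 : ℝ) := by
        rw [ENNReal.mul_rpow_of_nonneg _ _ (by norm_num), ← ENNReal.rpow_two, ← ENNReal.rpow_mul]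
        norm_num

/-- **The energy bound behind (4.7)**: `(1 + (1+ε₀)^{10n}) E_{i,n}(t)^{1/2} ≤ ‖u(t)‖_{H¹⁰}`. [cite: Tao2016AveragedNS, Lemma 4.1 (4.7)] -/
theorem weight_mul_sqrt_modeEnergy_le (hε : 0 < ε₀) {t : ℝ} (hfin : FunctionSpaces.eFourierSobolevNorm 10 (u t) < ⊤) :
    (1 + (1 + ε₀) ^ ((10 : ℝ) * n)) * Real.sqrt (modeEnergy 𝒟 u i n t) ≤
      (FunctionSpaces.eFourierSobolevNorm 10 (u t)).toReal := by
  have hε' : 0 < 1 + ε₀ := by linarith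
  set K : ℝ := (1 + ((1 + ε₀) ^ n) ^ 2) ^ (-(5 : ℝ)) with hK
  have hK0 : 0 ≤ K := Real.rpow_nonneg (by positivity) _
  have h1 : ‖modeProjection 𝒟 i n (u t)‖ ≤ K * (FunctionSpaces.eFourierSobolevNorm 10 (u t)).toReal := by
    have h := sobolevWeight_enorm_modeProjection_le (𝒟 := 𝒟) hε' i n (u t)
    have hne : ENNReal.ofReal K * FunctionSpaces.eFourierSobolevNorm 10 (u t) ≠ ⊤ :=
      ENNReal.mul_ne_top ENNReal.ofReal_ne_top hfin.ne
    have h2 := ENNReal.toReal_mono hne h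
    rwa [← ofReal_norm, ENNReal.toReal_ofReal (norm_nonneg _), ENNReal.toReal_mul, ENNReal.toReal_ofReal hK0] at h2
  have hsqrt : Real.sqrt (modeEnergy 𝒟 u i n t) ≤ ‖modeProjection 𝒟 i n (u t)‖ := by
    rw [modeEnergy, Real.sqrt_le_left (norm_nonneg _)]
    nlinarith [sq_nonneg ‖modeProjection 𝒟 i n (u t)‖]
  have hw := weight_le_one hε' n
  calc (1 + (1 + ε₀) ^ ((10 : ℝ) * n)) * Real.sqrt (modeEnergy 𝒟 u i n t)
      ≤ (1 + (1 + ε₀) ^ ((10 : ℝ) * n)) * (K * (FunctionSpaces.eFourierSobolevNorm 10 (u t)).toReal) :=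
        mul_le_mul_of_nonneg_left (hsqrt.trans h1) (by positivity)
    _ = ((1 + (1 + ε₀) ^ ((10 : ℝ) * n)) * K) * (FunctionSpaces.eFourierSobolevNorm 10 (u t)).toReal := by ring
    _ ≤ 1 * (FunctionSpaces.eFourierSobolevNorm 10 (u t)).toReal :=
        mul_le_mul_of_nonneg_right hw ENNReal.toReal_nonneg
    _ = _ := one_mul _

/-- **The a priori bounds (4.6)–(4.7)** for a global mild solution, on every compact time
interval (the `H¹⁰` norm of an `H¹⁰`-continuous curve is locally bounded). [cite: Tao2016AveragedNS, Lemma 4.1 (4.6)–(4.7)] -/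
theorem apriori_of_mild (hε : 0 < ε₀) {T : L2C → L2C → L2C → ℂ} {u₀ : L2C}
    (hu : IsMildSolutionFor T u₀ (Ici 0) u) (T' : ℝ) :
    (∃ M : ℝ, ∀ t ∈ Icc 0 T', ∀ (i : Fin m) (n : ℤ),
        (1 + (1 + ε₀) ^ ((10 : ℝ) * n)) * |modeCoeff 𝒟 u i n t| ≤ M) ∧
      ∃ M : ℝ, ∀ t ∈ Icc 0 T', ∀ (i : Fin m) (n : ℤ),
        (1 + (1 + ε₀) ^ ((10 : ℝ) * n)) * Real.sqrt (modeEnergy 𝒟 u i n t) ≤ M := by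
  have hfin : ∀ t ∈ Icc 0 T', FunctionSpaces.eFourierSobolevNorm 10 (u t) < ⊤ := fun t ht => (hu.1 t ht.1).1
  obtain ⟨M, hM⟩ := (hu.2.1.mono (Icc_subset_Ici_self : Icc 0 T' ⊆ Ici 0)).exists_bound hfin
  exact ⟨⟨M, fun t ht i n => (weight_mul_abs_modeCoeff_le hε (hfin t ht)).trans (hM t ht)⟩,
    ⟨M, fun t ht i n => (weight_mul_sqrt_modeEnergy_le hε (hfin t ht)).trans (hM t ht)⟩⟩

end Apriori

/-! ## Part XIII: Lemma 4.1 and the reduction chain -/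

/-- **Tao 2016, Lemma 4.1 (Equations of motion) — discharge of the named fact `equationsOfMotion`.**
For `0 < ε₀ < 1`, wavelet data `𝒟`, structure constants `α` obeying (4.2)–(4.3), the implied
constants are `K₁ = 4√2π²(1+ε₀/2)²` ((4.10), from `‖Δψ_{i,n}‖`-type bounds: `Λ_n = 4π²((1+ε₀)ⁿ(1+ε₀/2))²`
bounds the heat rate on the frequency support of the mode) and `K₂ = 8π²(1+ε₀/2)²` ((4.12)); for every
datum mode `(i₀, n₀)` and every global mild solution `u` of (3.3) with datum `ψ_{i₀,n₀}`, the
coefficients `X_{i,n} = ⟨u, ψ_{i,n}⟩` and local energies `E_{i,n} = ½‖u_{i,n}‖²` obey (4.6)–(4.13):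
regularity and the derivative formulas from the Duhamel representation `u_{i,n}(t) = m_t(D)ψ_{i,n}`
(`TaoCascadeDuhamel.lean`), the a priori bounds from Plancherel and `u ∈ C⁰_t H¹⁰_x`, the initial
conditions from orthonormality, and (4.13) from (4.3) by the ODE-level Gronwall argument
(`TaoCascade.CascadeODESolution.of_cancelling`). [cite: Tao2016AveragedNS, Lemma 4.1] -/
theorem equationsOfMotion_holds : equationsOfMotion := by
  intro ε₀ hε _hε1 m 𝒟 α _hsymm hcanc
  refine ⟨4 * Real.sqrt 2 * Real.pi ^ 2 * (1 + ε₀ / 2) ^ 2, 8 * Real.pi ^ 2 * (1 + ε₀ / 2) ^ 2,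
    by positivity, by positivity, fun i₀ n₀ u hu => ?_⟩
  exact TaoCascade.CascadeODESolution.of_cancelling hε hcanc
    (fun i n => contDiffOn_modeCoeff_of_mild (i₀ := i₀) (n₀ := n₀) hε hu)
    (fun i n => contDiffOn_modeEnergy_of_mild (i₀ := i₀) (n₀ := n₀) hε hu)
    (fun i n t _ => modeEnergy_nonneg 𝒟 u i n t)
    (fun T _ => (apriori_of_mild hε hu T).1)
    (fun T _ => (apriori_of_mild hε hu T).2)
    (fun i n => (init_of_mild (i := i) (n := n) hε hu).2)
    (fun i n => (init_of_mild (i := i) (n := n) hε hu).1)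
    (fun i n t ht => motion_of_mild hε hu ht)
    (fun i n t ht => energy_ineq_of_mild (i₀ := i₀) (n₀ := n₀) hε hu ht)
    (fun i n t ht => defect_lower_of_mild (i₀ := i₀) (n₀ := n₀) hε hu ht)
    (fun i n t ht => defect_upper_of_mild hε hu ht)

/-- **Theorem 3.3 from Theorem 4.2**, now that Lemma 4.1 is a theorem: the accepted reduction
`localCascade_blowup_of_equationsOfMotion` fed with `equationsOfMotion_holds`. [cite: Tao2016AveragedNS, §4 pp. 21–23] -/
theorem localCascade_blowup_of_odeBlowup (h42 : TaoCascade.odeBlowup) : localCascade_blowup :=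
  localCascade_blowup_of_equationsOfMotion equationsOfMotion_holds h42

/-- **Theorem 3.3 from Theorem 6.2** (the only remaining named fact of the chain
Thm 3.3 ⇐ Lemma 4.1 + Thm 4.2 ⇐ Thm 6.2). [cite: Tao2016AveragedNS, §4 and §6.1] -/
theorem localCascade_blowup_of_noGlobalODESolution (h62 : TaoCascade.noGlobalODESolution) :
    localCascade_blowup :=
  localCascade_blowup_of_odeBlowup (TaoCascade.odeBlowup_of_noGlobalODESolution h62)

/-- **Theorem 1.5 from Theorem 3.2 and Theorem 6.2** (Lemma 4.1 discharged in the chain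
`averagedNS_blowup_of_leaves`). [cite: Tao2016AveragedNS, Thm. 1.5] -/
theorem averagedNS_blowup_of_isAveraged_of_noGlobalODESolution (h32 : localCascade_isAveraged)
    (h62 : TaoCascade.noGlobalODESolution) : averagedNS_blowup :=
  averagedNS_blowup_of_leaves h32 equationsOfMotion_holds h62

end Literature.Analysis.FluidPDE.Tao2016
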